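import Summits.QuantumFields.YangMills.Theorems.BalabanLadderROTTiltSplitConverse
import Summits.QuantumFields.YangMills.Theorems.BalabanLadderROTTiltBoundaryDecayClosers
import HarnessLib

/-!
# Crux `ROT` (stmt-QuantumFields-20042): the boundary-decay input with NON-DEGENERATE cubes — erratum and the repaired chain

Helper file of the fleet lead `ym-spine-20042-p1` (generation g4), `--supports stmt-QuantumFields-20042` (count-neutral).

ERRATUM (located by the same seat, same session).  The infrared input as typed in `Theorems/BalabanLadderROTTiltBoundaryDecay.lean`
(binder `hdecay` of `tiltInsensitivityOn_of_boundaryDecay`, p484693) and named in `Theorems/BalabanLadderROTClassDefs.lean` §5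
(`BoundaryDecayInUnits`, `BoundaryDecayAll`, p485718) quantifies over ALL cubes `(c, b)` including the EMPTY cube `b = 0`: there the depth
is identically `0`, so `d = 0` is admissible for every support, the right-hand side `K₆·M·0⁴·e⁰` vanishes, while the kernel of the empty
edge set is evaluation at the exterior — so the hypothesis forces every bounded continuous cylinder observable to be CONSTANT
(`boundaryDecayInUnits_degenerate` below).  For a non-trivial gauge group it is therefore unsatisfiable and the theorems taking it are
vacuous.  The intended input needs the side condition `1 ≤ b` (non-degenerate cubes); with it nothing else changes: small cubes are the
trivial regime (`|Δ| ≤ 2M ≤ K₆ M b⁴`), large physical cubes the mass-gap regime.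

THIS FILE lands the repaired chain with the side condition `1 ≤ b` inserted (hypothesis `hdecay⁺`, inline):
* §1 `kerE_eq_self_of_forall_not_mem` (the kernel average of an observable not read inside `Λ` is its value), `not_mem_cubeEdges_zero`,
  `depth_zero`, and the degeneracy certificate `boundaryDecayInUnits_degenerate`;
* §2 `tiltInsensitivityOn_of_boundaryDecayPos : hdecay⁺ → TiltInsensitivityOn G r a t.tiltCell (fittedClass t.q)` — the per-step lemma
  `norm_tilt_bracket_step_le` (p484693) asks the decay only at depth `⌊⌊L/4⌋/2⌋ ≥ 1`, where the empty cube carries no support, so its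
  hypothesis follows from `hdecay⁺`; the limit argument is repeated verbatim;
* §3 closers with `hdecay⁺` for all `(G, r, a)`: `ti_of_boundaryDecayPos`, `rotRev2'_of_nrot3_of_boundaryDecayPos`,
  `tiltedRegComparisonOn_iff_latticeKingWardOn_of_boundaryDecayPos`.

Census unchanged in substance: open content of `ROT` rev 2′ = `NROT3(S₅)` + the (repaired) boundary-decay input.  0 definitions, 0 sorry.
-/

set_option autoImplicit false

noncomputable section

open scoped SchwartzMap BigOperators
open MeasureTheory Filter Topology Metric
open Literature.MathematicalPhysics.QuantumFieldTheory Literature.MathematicalPhysics.QuantumLattice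
open Literature.MathematicalPhysics.AQFT
open Literature.Probability.LatticeModels (box Site mem_box glueWith glueWith_apply_not_mem)
open Summit.QuantumFields.YangMills.Cruxes.OSLegsFromFemtoAndGap.DlrCollarTransfer
open Summit.QuantumFields.YangMills.Cruxes.OSLegsFromFemtoAndGap.DlrCollarTransfer.StubLower (mem_cubeSites_iff)
open Summit.QuantumFields.YangMills.Cruxes.OSLegsAtWeakCouplingC.Sketch (tendsto_riemann_sum)
open Summit.QuantumFields.YangMills.Cruxes.OSLegsAtWeakCouplingC.Y2Bridge
open Summit.QuantumFields.YangMills.Theorems.OSLegsFromFemtoAndGap (latticeDist)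
open Summit.QuantumFields.YangMills.Theorems.OSLegsFromFemtoAndGap.StubLower (exists_abs_curvature_le)
open Summit.QuantumFields.YangMills.Theorems.NPointIsotropy.Negative (E4)

namespace Summit.QuantumFields.YangMills.Theorems.ROT

open PythTriple

section Degenerate

variable {G : Type} [Group G] [TopologicalSpace G] [IsTopologicalGroup G] [CompactSpace G]
  [MeasurableSpace G] [BorelSpace G]

/-- The empty cube has no interior edges. [folklore] -/
theorem not_mem_cubeEdges_zero (c : Fin 4 → ℤ) (e : Literature.MathematicalPhysics.QuantumLattice.ZdEdge 4) :
    e ∉ cubeEdges c 0 := fun he => by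
  have h := ((mem_cubeSites_iff c 0 e.1).1 (fst_mem_cubeSites_of_mem_cubeEdges he)) 0
  push_cast at h
  linarith [h.1, h.2]

/-- The empty cube has depth identically `0`. [folklore] -/
theorem depth_zero (c x : Fin 4 → ℤ) : depth c 0 x = 0 := by
  apply Nat.eq_zero_of_le_zero
  unfold depth
  refine (Finset.inf'_le _ (Finset.mem_univ (0 : Fin 4))).trans ?_
  rcases le_or_gt (c 0) (x 0) with h | h
  · have : (c 0 + ((0 : ℕ) : ℤ) - x 0).toNat = 0 := Int.toNat_eq_zero.2 (by push_cast; linarith)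
    rw [this]; exact min_le_right _ _
  · have : (x 0 - c 0 + 1).toNat = 0 := Int.toNat_eq_zero.2 (by linarith)
    rw [this]; exact min_le_left _ _

/-- **The kernel average of an observable not read inside `Λ` is its value at the exterior**: if `A` is a cylinder observable whose support
misses `Λ`, then `∫ A dγ_Λ(· | η) = A η` (the tilting weight cancels in the ratio). -/
theorem integral_ymSpecification_eq_self_of_forall_not_mem (r : LatticeRep G) (β : ℝ)
    (Λ : Finset (Literature.MathematicalPhysics.QuantumLattice.ZdEdge 4)) {A : LGConfig 4 G → ℝ} (hAm : Measurable A)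
    {S : Finset (Literature.MathematicalPhysics.QuantumLattice.ZdEdge 4)} (hAS : IsCylinder A S) (hS : ∀ e ∈ S, e ∉ Λ)
    (η : LGConfig 4 G) : ∫ U, A U ∂(ymSpecification r.ρ β Λ η) = A η := by
  haveI := r.secondCountableTopology
  have hglue : ∀ ζ : ↥Λ → G, A (glueWith Λ ζ η) = A η := fun ζ =>
    hAS fun e he => glueWith_apply_not_mem _ _ _ (hS e (Finset.mem_coe.1 he))
  rw [integral_ymSpecification r.ρ r.continuous β Λ hAm]
  simp_rw [hglue]
  rw [integral_const_mul, mul_div_assoc, div_self (normaliser_pos r.ρ r.continuous β Λ η).ne', mul_one]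

/-- For the empty cube the kernel `kerE` is evaluation at the exterior. -/
theorem kerE_zero_eq_self (r : LatticeRep G) (β : ℝ) (c : Fin 4 → ℤ) {A : LGConfig 4 G → ℝ} (hAm : Measurable A)
    {S : Finset (Literature.MathematicalPhysics.QuantumLattice.ZdEdge 4)} (hAS : IsCylinder A S) (η : LGConfig 4 G) :
    kerE G r β c 0 η A = A η :=
  integral_ymSpecification_eq_self_of_forall_not_mem r β _ hAm hAS (fun e _ => not_mem_cubeEdges_zero c e) η

/-- **Degeneracy certificate for `BoundaryDecayInUnits` (ClassDefs §5, p485718) as typed**: it forces every bounded continuous cylinder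
observable of the infinite lattice to be constant (instance: the empty cube `b = 0`, depth `0`, where the bound reads `|A η − A η'| ≤ 0`).  Hence
for a non-trivial gauge group it is unsatisfiable; the intended input is the `1 ≤ b` form used below. -/
theorem boundaryDecayInUnits_degenerate (r : LatticeRep G) (a : ℝ → ℝ) (h : BoundaryDecayInUnits G r a)
    {A : LGConfig 4 G → ℝ} (hA : Continuous A) {M : ℝ} (hM : ∀ U, |A U| ≤ M)
    {S : Finset (Literature.MathematicalPhysics.QuantumLattice.ZdEdge 4)} (hAS : IsCylinder A S) (η η' : LGConfig 4 G) :
    A η = A η' := by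
  haveI := r.secondCountableTopology
  obtain ⟨c₆, β₆, K₆, -, hdec⟩ := h
  have hb := hdec β₆ le_rfl 0 0 0 η η' A M S hA hM hAS (fun e _ => Nat.zero_le _)
  rw [kerE_zero_eq_self r β₆ 0 hA.measurable hAS η, kerE_zero_eq_self r β₆ 0 hA.measurable hAS η'] at hb
  have h0 : |A η - A η'| ≤ 0 := by simpa using hb
  exact sub_eq_zero.1 (abs_nonpos_iff.1 h0)

end Degenerate

/-! ## §2 The repaired chain: boundary decay on NON-DEGENERATE cubes -/

section Main

variable {G : Type} [Group G] [TopologicalSpace G] [IsTopologicalGroup G] [CompactSpace G]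
  [MeasurableSpace G] [BorelSpace G]

/-- **The tilt bracket vanishes along admissible schemes, given exponential decay of boundary influence in units `a` on NON-DEGENERATE cubes.**
Same statement as `tiltInsensitivityOn_of_boundaryDecay` with the side condition `1 ≤ b` in the input: for `β ≥ β₆`, every cube `(c, b)`
with `b ≥ 1`, every depth `d`, exteriors `η, η'`, and every bounded continuous cylinder observable `A` (`|A| ≤ M`) supported at depth `≥ d`,
`|kerE η A − kerE η' A| ≤ K₆·M·b⁴·exp(−c₆·a(β)·d)`.  (The per-step estimate asks the decay at depth `⌊⌊L/4⌋/2⌋ ≥ 1` only, where the empty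
cube carries no support and its kernel is evaluation.) -/
theorem tiltInsensitivityOn_of_boundaryDecayPos (t : PythTriple) (r : LatticeRep G) (a : ℝ → ℝ)
    (hdecay : ∃ (c₆ β₆ K₆ : ℝ), 0 < c₆ ∧ ∀ β : ℝ, β₆ ≤ β →
      ∀ (c : Fin 4 → ℤ) (b d : ℕ) (η η' : LGConfig 4 G) (A : LGConfig 4 G → ℝ) (M : ℝ)
        (S : Finset (Literature.MathematicalPhysics.QuantumLattice.ZdEdge 4)), 1 ≤ b →
        Continuous A → (∀ U, |A U| ≤ M) → IsCylinder A S → (∀ e ∈ S, d ≤ depth c b e.1) →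
        |kerE G r β c b η A - kerE G r β c b η' A| ≤ K₆ * M * (b : ℝ) ^ 4 * Real.exp (-(c₆ * a β * d))) :
    TiltInsensitivityOn G r a t.tiltCell (fittedClass t.q) := by
  obtain ⟨c₆, β₆, K₆, hc₆, hdec⟩ := hdecay
  intro sch hS hunits hβ hranges
  refine ⟨1, one_pos, fun n _hn F hF => ?_⟩
  obtain ⟨-, hFc, -, -⟩ := hF
  obtain ⟨B, hB0, hB⟩ := exists_abs_curvature_le r
  haveI := r.secondCountableTopology
  -- support radius of `F`
  obtain ⟨ρ, hρ⟩ : ∃ ρ : ℝ, tsupport (F : (Fin n → E4) → ℂ) ⊆ closedBall (0 : Fin n → E4) ρ :=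
    hFc.isCompact.isBounded.subset_closedBall 0
  -- scheme data
  have hapos : ∀ k, 0 < sch.a k := sch.a_pos
  have ha0 : Tendsto sch.a atTop (𝓝 0) := sch.tendsto_a
  have haL : Tendsto (fun k => sch.a k * (sch.L k : ℝ)) atTop atTop := sch.tendsto_L
  have ha1 : ∀ k, sch.a k ≤ 1 := fun k => (hranges k).2.1.trans (by norm_num)
  have hLa : ∀ k, (sch.a k)⁻¹ * (sch.a k)⁻¹ ≤ sch.L k := fun k => (hranges k).2.2.2
  -- the rate and the Riemann sums
  have hrate := tendsto_boundary_rate sch.a sch.L hapos ha1 hLa haL hc₆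
    (2 * (max K₆ 0 * (2 * B) ^ n) + n * (2 * B) ^ (n - 1) * (2 * (max K₆ 0 * B))) (4 * n)
  have hRiem : Tendsto (fun k => sch.a k ^ (4 * n) *
      ∑ x ∈ Fintype.piFinset (fun _ : Fin n => box 4 (sch.L k)), ‖F (fun i => sch.a k • siteToE (x i))‖)
      atTop (𝓝 (∫ y, ‖F y‖)) :=
    tendsto_riemann_sum (fun y => ‖F y‖) F.continuous.norm hFc.norm sch.a sch.L hapos ha0 haL
  -- the straight torus is the axis cell
  have hS' : ∀ k, latticeDist r.ρ (sch.β k) (sch.L k) (sch.a k) r.curvature.F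
      (wilsonTorusMean r.ρ (sch.β k) (sch.L k) r.curvature.F) n F =
      (axisCell (sch.L k)).dist r.ρ (sch.β k) (fun x => sch.a k • siteToE x) r.curvature.F
        ((axisCell (sch.L k)).mean r.ρ (sch.β k) r.curvature.F) n F := fun k => by
    rw [dist_axisCell, mean_axisCell]
  simp_rw [hS']
  -- squeeze against rate × Riemann sum
  have hlim := hrate.mul hRiem
  rw [zero_mul] at hlim
  refine squeeze_zero_norm' ?_ hlim
  filter_upwards [hβ.eventually_ge_atTop β₆, haL.eventually_ge_atTop (8 * ρ + 8)] with k hkβ hkL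
  have hL14 : 14 ≤ sch.L k := (hranges k).2.2.1
  have hd1 : 1 ≤ sch.L k / 4 / 2 := by omega
  -- the per-step decay hypothesis at depth `⌊⌊L/4⌋/2⌋ ≥ 1`: non-degenerate cubes from `hdecay`, the empty cube is trivial
  have hdecβ : ∀ (c : Fin 4 → ℤ) (b : ℕ) (η η' : LGConfig 4 G) (A : LGConfig 4 G → ℝ) (M : ℝ)
      (S : Finset (Literature.MathematicalPhysics.QuantumLattice.ZdEdge 4)),
      Continuous A → (∀ U, |A U| ≤ M) → IsCylinder A S → (∀ e ∈ S, sch.L k / 4 / 2 ≤ depth c b e.1) →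
      |kerE G r (sch.β k) c b η A - kerE G r (sch.β k) c b η' A| ≤
        K₆ * M * (b : ℝ) ^ 4 * Real.exp (-(c₆ * a (sch.β k) * ((sch.L k / 4 / 2 : ℕ) : ℝ))) := by
    intro c b η η' A M S hA hM hAS hd
    rcases Nat.eq_zero_or_pos b with hb | hb
    · subst hb
      have hS0 : ∀ e ∈ S, False := fun e he => by
        have h := hd e he
        rw [depth_zero] at h
        omega
      rw [kerE_zero_eq_self r (sch.β k) c hA.measurable hAS η, kerE_zero_eq_self r (sch.β k) c hA.measurable hAS η']
      have hconst : A η = A η' := hAS fun e he => (hS0 e (Finset.mem_coe.1 he)).elim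
      rw [hconst, sub_self, abs_zero]
      simp
    · exact hdec (sch.β k) hkβ c b _ η η' A M S hb hA hM hAS hd
  have h := norm_tilt_bracket_step_le t r (sch.β k)
    (X := Real.exp (-(c₆ * a (sch.β k) * ((sch.L k / 4 / 2 : ℕ) : ℝ)))) (Real.exp_pos _).le hdecβ
    (hS k) hL14 (hapos k) (ha1 k) hB0 hB F hρ hkL
  rw [← hunits k] at h
  exact h

/-! ## §3 Closers with the repaired input -/

/-- **`TI ⇐ boundary-influence decay on non-degenerate cubes`**, for the tilt cells of any Pythagorean triple on its fitted class. -/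
theorem ti_of_boundaryDecayPos (t : PythTriple)
    (hBD : ∀ (G : Type) [Group G] [TopologicalSpace G] [IsTopologicalGroup G] [CompactSpace G],
      IsCompactSimpleLieGroup G → letI : MeasurableSpace G := borel G; haveI : BorelSpace G := ⟨rfl⟩;
      ∀ (r : LatticeRep G) (a : ℝ → ℝ), ∃ (c₆ β₆ K₆ : ℝ), 0 < c₆ ∧ ∀ β : ℝ, β₆ ≤ β →
        ∀ (c : Fin 4 → ℤ) (b d : ℕ) (η η' : LGConfig 4 G) (A : LGConfig 4 G → ℝ) (M : ℝ)
          (S : Finset (Literature.MathematicalPhysics.QuantumLattice.ZdEdge 4)), 1 ≤ b →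
          Continuous A → (∀ U, |A U| ≤ M) → IsCylinder A S → (∀ e ∈ S, d ≤ depth c b e.1) →
          |kerE G r β c b η A - kerE G r β c b η' A| ≤ K₆ * M * (b : ℝ) ^ 4 * Real.exp (-(c₆ * a β * d))) :
    TI t.tiltCell (fittedClass t.q) := by
  intro G _ _ _ _ hG
  letI : MeasurableSpace G := borel G
  haveI : BorelSpace G := ⟨rfl⟩
  intro r a _ _ _ _
  exact tiltInsensitivityOn_of_boundaryDecayPos t r a (hBD G hG r a)

/-- **`ROT` rev 2′ ⇐ N-ROT.3 (King's data) ∧ boundary-influence decay on non-degenerate cubes.** -/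
theorem rotRev2'_of_nrot3_of_boundaryDecayPos (h3 : NROT3 king345.tiltCell (Real.arcsin (3 / 5)) (fittedClass 5))
    (hBD : ∀ (G : Type) [Group G] [TopologicalSpace G] [IsTopologicalGroup G] [CompactSpace G],
      IsCompactSimpleLieGroup G → letI : MeasurableSpace G := borel G; haveI : BorelSpace G := ⟨rfl⟩;
      ∀ (r : LatticeRep G) (a : ℝ → ℝ), ∃ (c₆ β₆ K₆ : ℝ), 0 < c₆ ∧ ∀ β : ℝ, β₆ ≤ β →
        ∀ (c : Fin 4 → ℤ) (b d : ℕ) (η η' : LGConfig 4 G) (A : LGConfig 4 G → ℝ) (M : ℝ)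
          (S : Finset (Literature.MathematicalPhysics.QuantumLattice.ZdEdge 4)), 1 ≤ b →
          Continuous A → (∀ U, |A U| ≤ M) → IsCylinder A S → (∀ e ∈ S, d ≤ depth c b e.1) →
          |kerE G r β c b η A - kerE G r β c b η' A| ≤ K₆ * M * (b : ℝ) ^ 4 * Real.exp (-(c₆ * a β * d))) :
    ROTRev2' :=
  rotRev2'_of_tilt345 h3 (ti_of_boundaryDecayPos king345 hBD)

/-- **Modulo boundary-influence decay on non-degenerate cubes, N-ROT.3 on a tilt cell IS King's single-angle lattice Ward statement on the
fitted class.** -/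
theorem tiltedRegComparisonOn_iff_latticeKingWardOn_of_boundaryDecayPos (t : PythTriple) (r : LatticeRep G) (a : ℝ → ℝ) (θ : ℝ)
    (hdecay : ∃ (c₆ β₆ K₆ : ℝ), 0 < c₆ ∧ ∀ β : ℝ, β₆ ≤ β →
      ∀ (c : Fin 4 → ℤ) (b d : ℕ) (η η' : LGConfig 4 G) (A : LGConfig 4 G → ℝ) (M : ℝ)
        (S : Finset (Literature.MathematicalPhysics.QuantumLattice.ZdEdge 4)), 1 ≤ b →
        Continuous A → (∀ U, |A U| ≤ M) → IsCylinder A S → (∀ e ∈ S, d ≤ depth c b e.1) →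
        |kerE G r β c b η A - kerE G r β c b η' A| ≤ K₆ * M * (b : ℝ) ^ 4 * Real.exp (-(c₆ * a β * d))) :
    TiltedRegComparisonOn G r a t.tiltCell θ (fittedClass t.q) ↔ LatticeKingWardOn G r a ({θ} : Set ℝ) (fittedClass t.q) :=
  tiltedRegComparisonOn_iff_latticeKingWardOn r a t.tiltCell θ (fittedClass t.q)
    (tiltInsensitivityOn_of_boundaryDecayPos t r a hdecay)

end Main

end Summit.QuantumFields.YangMills.Theorems.ROT

end
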